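import Summits.Parity.GeneralizedHardyLittlewood.Theorems.GreenTaoLevelTwoGITwoCyclicInverseLocaliseFamily
import Summits.Parity.GeneralizedHardyLittlewood.Theorems.GreenTaoLevelTwoGITwoCyclicInverseTrilinearFamily
import Summits.Parity.GeneralizedHardyLittlewood.Theorems.GreenTaoLevelTwoGITwoCyclicInverseLocalisationPrelims

/-!
# Route `GreenTaoLevelTwo`, crux `GITwo` (stmt-Parity-21275), line `birth`, stub `stub_cyclicInverse`:
# C13 assembly, step 5: localisation, the `fgh`-lemma and the choice of the translate (GT08a §9
# Steps 3–4, from the `y`-family to one local linear-phase correlation)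

Eighty-fourth helper file toward the XL stub `stub_cyclicInverse` (B. Green, T. Tao, *An inverse
theorem for the Gowers `U³(G)` norm*, arXiv:math/0503014, Thm. 68 = PEMS 51 (2008) Thm. 12.8).
Block C13 (§9 Step 3 end and Step 4: "By the pigeonhole principle there exists `w ∈ B₄` …", "Let us
now apply Lemma (fgh-bohr) … `𝔼_y ‖f̄(x+w+y)e(M(x+w)·(x+w))‖_{u²(B₅)} ≥ 2^{-C₄-4}η^{C'₄}`"): the
landed steps `exists_localised_family` (Lemma 21 (ii) + pigeonhole) and `exists_freq_family`
(Lemma 23) chained, followed by the size comparison `#(B₅+B₄) ≤ 2#B₄` (`card_bohr_add_bohr_le`) and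
the choice of `y` (`exists_translate_ge_of_sum_ge`), for an abstract bounded kernel `G` that
factorises as `G y h (x₀+w) = Φ x₀ y w · Ψ x₀ y (w+h)` (as the §9 kernel does).  Def-free:

* `exists_localised_linear_correlation` — from `K₀ N #B₄² ≤ Σ_y |Σ_{h∈B₄} b'(y,h) Σ_{x∈B₄} G y h x|`:
  `∃ x₀ ∈ B₄, ∃ y ξ, (K₀ − 200 d ε) #B₅ / 2 ≤ |Σ_{w∈B₅} Φ x₀ y w · e(wξ/N)|`.

References: [GreenTao2008U3Inverse] arXiv:math/0503014, §9 Steps 3–4.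
-/

noncomputable section

namespace Summit.Parity.GeneralizedHardyLittlewood.GreenTaoLevelTwoGITwoCyclicInverse

open Finset ZMod
open scoped Pointwise
open Literature.NumberTheory.Sieve

variable {N : ℕ} [NeZero N]

/-- **§9 Steps 3–4: localisation + `fgh`-lemma + choice of the translate.**  See the module
docstring. [cite: GreenTao2008U3Inverse, §9 Steps 3–4] -/
theorem exists_localised_linear_correlation (S₃ : Finset (ZMod N))
    (hS : S₃.Nonempty) {ρ₄ ρ₅ ε K₀ : ℝ} (hρ₄ : 0 < ρ₄) (hρ₅ : 0 < ρ₅) (hρ₅ε : ρ₅ ≤ ε * ρ₄)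
    (hε0 : 0 < ε) (hε100 : ε ≤ 1 / (100 * (#S₃ : ℝ)))
    (B₄ B₅ : Finset (ZMod N))
    (hB₄ : B₄ = ({x : ZMod N | ∀ ξ ∈ S₃, ‖ZMod.toAddCircle (x * ξ)‖ < ρ₄} : Finset (ZMod N)))
    (hB₅ : B₅ = ({x : ZMod N | ∀ ξ ∈ S₃, ‖ZMod.toAddCircle (x * ξ)‖ < ρ₅} : Finset (ZMod N)))
    (hreg : ∀ r : ℝ, |r| ≤ 1 / (100 * (#S₃ : ℝ)) →
      (1 - 100 * (#S₃ : ℝ) * |r|) * #{x : ZMod N | ∀ ξ ∈ S₃, ‖ZMod.toAddCircle (x * ξ)‖ < ρ₄} ≤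
          #{x : ZMod N | ∀ ξ ∈ S₃, ‖ZMod.toAddCircle (x * ξ)‖ < (1 + r) * ρ₄} ∧
        (#{x : ZMod N | ∀ ξ ∈ S₃, ‖ZMod.toAddCircle (x * ξ)‖ < (1 + r) * ρ₄} : ℝ) ≤
          (1 + 100 * (#S₃ : ℝ) * |r|) * #{x : ZMod N | ∀ ξ ∈ S₃, ‖ZMod.toAddCircle (x * ξ)‖ < ρ₄})
    (G : ZMod N → ZMod N → ZMod N → ℂ) (hG : ∀ y h x, ‖G y h x‖ ≤ 1)
    (b' : ZMod N → ZMod N → ℂ) (hb' : ∀ y h, ‖b' y h‖ ≤ 1)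
    (Φ Ψ : ZMod N → ZMod N → ZMod N → ℂ) (hΨ : ∀ x₀ y v, ‖Ψ x₀ y v‖ ≤ 1)
    (hfac : ∀ x₀ y h w, G y h (x₀ + w) = Φ x₀ y w * Ψ x₀ y (w + h))
    (hK : K₀ * N * (#B₄ : ℝ) ^ 2 ≤ ∑ y : ZMod N, ‖∑ h ∈ B₄, b' y h * ∑ x ∈ B₄, G y h x‖) :
    ∃ x₀ ∈ B₄, ∃ y ξ : ZMod N,
      (K₀ - 200 * (#S₃ : ℝ) * ε) * #B₅ / 2 ≤ ‖∑ w ∈ B₅, Φ x₀ y w * stdAddChar (w * ξ)‖ := by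
  classical
  have hNpos : (0 : ℝ) < N := by exact_mod_cast Nat.pos_of_ne_zero (NeZero.ne N)
  have hmemB₅ : ∀ w, w ∈ B₅ → ∀ ξ ∈ S₃, ‖ZMod.toAddCircle (w * ξ)‖ < ρ₅ := fun w hw => by
    rw [hB₅, mem_filter] at hw; exact hw.2
  have hB₅small : ∀ w ∈ B₅, ∀ ξ ∈ S₃, ‖ZMod.toAddCircle (w * ξ)‖ ≤ ε * ρ₄ :=
    fun w hw ξ hξ => (hmemB₅ w hw ξ hξ).le.trans hρ₅ε
  have hc4 : (1 : ℝ) ≤ #B₄ := by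
    have h0 : (0 : ZMod N) ∈ B₄ := by
      rw [hB₄, mem_filter]
      exact ⟨mem_univ _, fun ξ _ => by rw [zero_mul, map_zero, norm_zero]; exact hρ₄⟩
    exact_mod_cast Finset.card_pos.mpr ⟨0, h0⟩
  have hc4pos : (0 : ℝ) < #B₄ := by linarith
  have hc5 : (0 : ℝ) ≤ #B₅ := Nat.cast_nonneg _
  -- Step 1: localisation and pigeonhole in `x₀`
  have hK' := hK
  rw [hB₄] at hK'
  obtain ⟨x₀, hx₀, hloc⟩ := exists_localised_family S₃ hS hρ₄ hε0 hε100 hreg hB₅small G hG b' hb' hK'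
  rw [← hB₄] at hx₀ hloc
  refine ⟨x₀, hx₀, ?_⟩
  -- Step 2: the `fgh`-lemma inside the family
  have hfam : ∑ y : ZMod N, ‖∑ h ∈ B₄, b' y h * ∑ w ∈ B₅, G y h (x₀ + w)‖ =
      ∑ y : ZMod N, ‖∑ h ∈ B₄, b' y h * ∑ w ∈ B₅, Φ x₀ y w * Ψ x₀ y (w + h)‖ := by
    refine Finset.sum_congr rfl fun y _ => ?_
    congr 1
    refine Finset.sum_congr rfl fun h _ => ?_
    congr 1
    exact Finset.sum_congr rfl fun w _ => hfac x₀ y h w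
  obtain ⟨ξ, hξ⟩ := exists_freq_family B₄ B₅ (Φ x₀) (Ψ x₀) b' (fun y h _ => hb' y h) (hΨ x₀)
  -- Step 3: `#(B₅ + B₄) ≤ 2 #B₄`, so `√(#B₄ #(B₅+B₄)) ≤ 2 #B₄`
  have hsum_card : (#(B₅ + B₄) : ℝ) ≤ 2 * #B₄ := by
    have hsmall : ρ₅ / ρ₄ ≤ 1 / (100 * (#S₃ : ℝ)) := by
      rw [div_le_iff₀ hρ₄]
      calc ρ₅ ≤ ε * ρ₄ := hρ₅ε
        _ ≤ 1 / (100 * (#S₃ : ℝ)) * ρ₄ := mul_le_mul_of_nonneg_right hε100 hρ₄.le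
    have h1 := card_bohr_add_bohr_le S₃ hρ₄ hρ₅ hsmall hreg
    rw [← hB₄, ← hB₅] at h1
    have hd1 : (1 : ℝ) ≤ #S₃ := by exact_mod_cast Nat.one_le_iff_ne_zero.mpr (card_pos.mpr hS).ne'
    have h2 : 100 * (#S₃ : ℝ) * (ρ₅ / ρ₄) ≤ 1 := by
      have := mul_le_mul_of_nonneg_left hsmall (by positivity : (0 : ℝ) ≤ 100 * #S₃)
      rw [mul_one_div, div_self (by positivity)] at this
      exact this
    calc (#(B₅ + B₄) : ℝ) ≤ (1 + 100 * (#S₃ : ℝ) * (ρ₅ / ρ₄)) * #B₄ := h1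
      _ ≤ 2 * #B₄ := by nlinarith
  have hsqrt : Real.sqrt ((#B₄ : ℝ) * #(B₅ + B₄)) ≤ 2 * #B₄ := by
    calc Real.sqrt ((#B₄ : ℝ) * #(B₅ + B₄)) ≤ Real.sqrt ((2 * #B₄) ^ 2) :=
          Real.sqrt_le_sqrt (by nlinarith)
      _ = 2 * #B₄ := Real.sqrt_sq (by positivity)
  -- Step 4: combine
  have hP0 : 0 ≤ ∑ y : ZMod N, ‖∑ w ∈ B₅, Φ x₀ y w * stdAddChar (w * ξ y)‖ :=
    Finset.sum_nonneg fun y _ => norm_nonneg _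
  have hchain : K₀ * N * (#B₄ : ℝ) ^ 2 * #B₅ - 200 * (#S₃ : ℝ) * ε * N * (#B₄ : ℝ) ^ 2 * #B₅ ≤
      #B₄ * (2 * #B₄ * ∑ y : ZMod N, ‖∑ w ∈ B₅, Φ x₀ y w * stdAddChar (w * ξ y)‖) := by
    refine hloc.trans ?_
    rw [hfam]
    refine mul_le_mul_of_nonneg_left (hξ.trans ?_) hc4pos.le
    exact mul_le_mul_of_nonneg_right hsqrt hP0
  have hPge : (K₀ - 200 * (#S₃ : ℝ) * ε) * #B₅ / 2 * N ≤
      ∑ y : ZMod N, ‖∑ w ∈ B₅, Φ x₀ y w * stdAddChar (w * ξ y)‖ := by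
    have h2 : 0 < 2 * (#B₄ : ℝ) ^ 2 := by positivity
    have e : (#B₄ : ℝ) * (2 * #B₄ * ∑ y : ZMod N, ‖∑ w ∈ B₅, Φ x₀ y w * stdAddChar (w * ξ y)‖) =
        (2 * (#B₄ : ℝ) ^ 2) * ∑ y : ZMod N, ‖∑ w ∈ B₅, Φ x₀ y w * stdAddChar (w * ξ y)‖ := by ring
    have e2 : K₀ * N * (#B₄ : ℝ) ^ 2 * #B₅ - 200 * (#S₃ : ℝ) * ε * N * (#B₄ : ℝ) ^ 2 * #B₅ =
        (2 * (#B₄ : ℝ) ^ 2) * ((K₀ - 200 * (#S₃ : ℝ) * ε) * #B₅ / 2 * N) := by ring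
    rw [e, e2] at hchain
    exact le_of_mul_le_mul_left hchain h2
  -- Step 5: choose `y`
  obtain ⟨y, hy⟩ := exists_translate_ge_of_sum_ge
    (fun y => ‖∑ w ∈ B₅, Φ x₀ y w * stdAddChar (w * ξ y)‖) hPge
  exact ⟨y, ξ y, hy⟩

end Summit.Parity.GeneralizedHardyLittlewood.GreenTaoLevelTwoGITwoCyclicInverse
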